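import Mathlib
import Literature.NumberTheory.LFunctions.Zhang2022.Section13MeanSquareLEdge
import Literature.NumberTheory.LFunctions.Zhang2022.Section13MeanSquareTools
import Literature.NumberTheory.LFunctions.Zhang2022.Section13E1Reduction
import Literature.NumberTheory.LFunctions.Zhang2022.Section14GaussSums
import HarnessLib

/-!
# Zhang (2022) §13, (13.11): the mean square of `L(w,ψ)` over `Ψ` near the critical line,
# `Σ_{ψ}|L(w,ψ)|² ≪ 𝔓𝓛⁹` (WP14 item I3-L, single factor, 𝔓-form) — kernel-checked

Topic `Literature/NumberTheory/LFunctions/Zhang2022` (Landau–Siegel audit tree; verdict-neutral).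
Y. Zhang, *Discrete mean estimates and the Landau–Siegel zero*, arXiv:2211.02515v1 (2022)
[Zhang2022LandauSiegel] — **an unrefereed manuscript under adjudication; nothing here asserts or denies
its Theorems 1–2.** ZHANG-L discharge lane, WP14 §13 programme under the leaf h1311
`Skeleton.Eq1311Rel c′ c137` (GAP G-L3t6-3: (13.11) "`𝔈 = o(𝔓)` … Combining (2.34), Cauchy's inequality,
Proposition 7.1, Lemma 5.9, 6.1 and 3.3, we can verify", p. 75, tex L3806–L3817, not carried out in
print). Item **I3-L** of the programme's signature scratch v4 (`meanSq_L_le`, "the `L`-factor ALONE,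
𝔓-form", `kL = 9`): the printed parallel is §8 p. 44 ("By Lemma 6.1 and the large sieve inequality");
here Lemma 3.3 (i) (orthogonality, constant `1`) replaces the large sieve since every polynomial of
Lemma 6.1 has length `≤ P`.

PROVED (theorems only; no new definitions; no new named facts; (A) enters through Lemma 6.1):

* `meanSq_short_unimodular_le` — for a `ψ`-polynomial `Σ_{1≤n<N} ψ(n)n^{−s}g(n)` with `|g| ≤ 1` and
  `N − 1 ≤ ⌊P⌋`, on the strip `|σ − ½| ≤ 2α`: `Σ_{ψ∈T}|…|² ≤ e^{8π}·𝔓·(1 + log⌊P⌋)` (tree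
  `meanSq_floorP_le` = Lemma 3.3 (i) `Skeleton.lemma33a_sum_le` with `n^{−2σ} ≤ e^{8π}/n`);
* `meanSq_Kchar_le`, `meanSq_Nchar_le` — `K(w,ψ)` (length `2P₄ ≤ P`) and `N(w,ψ)` (length `2T² ≤ P`):
  `≤ 2e^{8π}·𝔓·𝓛⁹`; `meanSq_E1main_le` — `Σ_{ψ∈T} E₁(w,ψ)² ≤ 8πe^{8π}·𝔓` (closer-2's reduction
  `sum_E1main_sq_mul_le_of_pointwise` over the `T³`-polynomial, `𝓛³⁹ ≤ 𝓛¹³⁶`); `card_le_frakP` —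
  `#T ≤ 𝔓` (Lemma 3.3 (i) at the constant polynomial);
* `meanSq_L_le` — **I3-L**: under (A), for all large `D`, every finite `T ⊆ Ψ` and every `w` with
  `|Re w − ½| ≤ α`, `|Im w − 2πt₀| ≤ 𝓛₁ + 1`: `Σ_{ψ∈T} |L(w,ψ)|² ≤ C·𝔓·𝓛⁹` — the edge
  `meanSq_L_mul_le_of_bounds` (Lemma 6.1 reflected, `Section13MeanSquareLEdge`) at `F ≡ 1` fed with the
  four bounds above at `w` and at the reflected point `1 − w̄`.

## References

* Y. Zhang, arXiv:2211.02515v1 (2022), §13 (13.11) p. 75; §8 p. 44, tex L2244–L2250; §6 Lemma 6.1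
  p. 31; §3 Lemma 3.3 (i) p. 14. [cite: Zhang2022LandauSiegel, §13 (13.11) p.75; §3 Lemma 3.3]
-/

noncomputable section

open Complex Real ComplexConjugate

namespace Literature.NumberTheory.LFunctions.Zhang2022.Typed.Section13

open Skeleton

/-! ## Sizes: the three lengths `2P₄`, `2T²`, `T³` are `≤ P` -/

/-- `⌈y⌉ − 1 ≤ ⌊Q⌋` once `0 ≤ y ≤ Q`. [folklore] -/
private theorem ceil_pred_le_floor_of_le {y Q : ℝ} (hy : 0 ≤ y) (h : y ≤ Q) : ⌈y⌉₊ - 1 ≤ ⌊Q⌋₊ := by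
  have h1 : (⌈y⌉₊ : ℝ) < y + 1 := Nat.ceil_lt_add_one hy
  have h2 : ((⌈y⌉₊ - 1 : ℕ) : ℝ) ≤ Q := by
    rcases Nat.eq_zero_or_pos ⌈y⌉₊ with h0 | hpos
    · rw [h0]; simp; linarith
    · rw [Nat.cast_sub hpos]; push_cast; linarith
  exact Nat.le_floor h2

/-- For `𝓛 ≥ 3`: `2T² ≤ P` and `T³ ≤ P` (`T = e^{𝓛^{1.1}}`, `P = e^{𝓛⁹}`, `𝓛^{1.1} ≤ 𝓛²`,
`3𝓛² + 1 ≤ 𝓛⁹`). [cite: Zhang2022LandauSiegel, §2 (2.6); §6 p.28] -/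
theorem bigT_lengths_le_bigP {D : ℕ} (hL : 3 ≤ ell D) :
    2 * bigT D ^ 2 ≤ bigP D ∧ bigT D ^ 3 ≤ bigP D := by
  have hL1 : 1 ≤ ell D := by linarith
  have hL0 : 0 < ell D := by linarith
  have h11 : ell D ^ (1.1 : ℝ) ≤ ell D ^ 2 := by
    calc ell D ^ (1.1 : ℝ) ≤ ell D ^ ((2 : ℕ) : ℝ) :=
          Real.rpow_le_rpow_of_exponent_le hL1 (by norm_num)
      _ = ell D ^ 2 := Real.rpow_natCast _ 2
  have h9 : 3 * ell D ^ 2 + 1 ≤ ell D ^ 9 := by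
    have h3 : (3 : ℝ) ^ 7 ≤ ell D ^ 7 := pow_le_pow_left₀ (by norm_num) hL 7
    have e : ell D ^ 9 = ell D ^ 7 * ell D ^ 2 := by ring
    nlinarith [pow_nonneg hL0.le 2, pow_nonneg hL0.le 7]
  have hT2 : bigT D ^ 2 = Real.exp (2 * ell D ^ (1.1 : ℝ)) := by
    rw [bigT, ← Real.exp_nat_mul]; norm_num
  have hT3 : bigT D ^ 3 = Real.exp (3 * ell D ^ (1.1 : ℝ)) := by
    rw [bigT, ← Real.exp_nat_mul]; norm_num
  have hr0 : 0 ≤ ell D ^ (1.1 : ℝ) := Real.rpow_nonneg hL0.le _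
  constructor
  · rw [hT2, bigP]
    calc 2 * Real.exp (2 * ell D ^ (1.1 : ℝ)) ≤ Real.exp 1 * Real.exp (2 * ell D ^ (1.1 : ℝ)) := by
          have : (2 : ℝ) ≤ Real.exp 1 := by linarith [Real.add_one_le_exp (1 : ℝ)]
          exact mul_le_mul_of_nonneg_right this (Real.exp_pos _).le
      _ = Real.exp (1 + 2 * ell D ^ (1.1 : ℝ)) := by rw [Real.exp_add]
      _ ≤ Real.exp (ell D ^ 9) := Real.exp_le_exp.mpr (by nlinarith)
  · rw [hT3, bigP]
    exact Real.exp_le_exp.mpr (by nlinarith)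

/-! ## Lemma 3.3 (i) for a short unimodular-coefficient polynomial -/

/-- **Mean square of a short `ψ`-polynomial with coefficients `|g| ≤ 1`** (the shape of `K`, `N` and the
`E₁`-polynomial of Lemma 6.1): for `𝓛 ≥ 1`, `|Re s − ½| ≤ 2α`, `N − 1 ≤ ⌊P⌋` and any finite `T ⊆ Ψ`,
`Σ_{ψ∈T} |Σ_{1≤n<N} ψ(n)n^{−s}g(n)|² ≤ e^{8π}·𝔓·(1 + log⌊P⌋)` (Lemma 3.3 (i), tree
`meanSq_floorP_le`, and `Σ_{n≤⌊P⌋}|g·1_{n<N}|²/n ≤ 1 + log⌊P⌋`).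
[cite: Zhang2022LandauSiegel, §3 Lemma 3.3 (i) p.14; §13 p.75] -/
theorem meanSq_short_unimodular_le {D : ℕ} (hL : 1 ≤ ell D) (T : Finset (Chr D)) {s : ℂ}
    (hs : |s.re - 1 / 2| ≤ 2 * alpha D) {N : ℕ} (hN : N - 1 ≤ ⌊bigP D⌋₊) (g : ℕ → ℂ)
    (hg : ∀ n, ‖g n‖ ≤ 1) :
    ∑ x ∈ T, ‖∑ n ∈ Finset.Ico 1 N, x.ψ (n : ZMod x.p) * (n : ℂ) ^ (-s) * g n‖ ^ 2 ≤
      Real.exp (8 * π) * frakP D * (1 + Real.log (⌊bigP D⌋₊ : ℕ)) := by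
  classical
  -- rewrite each polynomial over `Icc 1 ⌊P⌋` with the truncated coefficients
  have hrew : ∀ x : Chr D, ∑ n ∈ Finset.Ico 1 N, x.ψ (n : ZMod x.p) * (n : ℂ) ^ (-s) * g n =
      ∑ n ∈ Finset.Icc 1 ⌊bigP D⌋₊,
        (fun n => if n < N then g n else 0) n * x.ψ (n : ZMod x.p) * (n : ℂ) ^ (-s) := by
    intro x
    rw [← sum_Ico_eq_sum_Icc_trunc hN g (fun n => x.ψ (n : ZMod x.p)) s]
    exact Finset.sum_congr rfl fun n _ => by ring
  simp_rw [hrew]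
  have hc : ∀ n, ‖(fun n => if n < N then g n else 0) n‖ ≤ 1 := fun n => by
    simp only
    split_ifs
    · exact hg n
    · simp
  have h1 := meanSq_floorP_le hL T hs (fun n => if n < N then g n else 0)
  have h2 := sum_norm_sq_div_le_one_add_log hc ⌊bigP D⌋₊
  have hP : 0 ≤ frakP D := by
    rw [frakP_eq_sum_primeWindow]; exact Finset.sum_nonneg fun p _ => Nat.cast_nonneg p
  exact h1.trans (mul_le_mul_of_nonneg_left h2 (by positivity))

/-- `1 + log⌊P⌋ ≤ 2𝓛⁹` (`log P = 𝓛⁹ ≥ 1`). [cite: Zhang2022LandauSiegel, §2 (2.6)] -/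
theorem one_add_log_floor_bigP_le {D : ℕ} (hL : 1 ≤ ell D) :
    1 + Real.log (⌊bigP D⌋₊ : ℕ) ≤ 2 * ell D ^ 9 := by
  have hP0 : 0 < bigP D := Real.exp_pos _
  have hlogP : Real.log (bigP D) = ell D ^ 9 := by rw [bigP, Real.log_exp]
  have h9 : (1 : ℝ) ≤ ell D ^ 9 := one_le_pow₀ hL
  rcases Nat.eq_zero_or_pos ⌊bigP D⌋₊ with h0 | hpos
  · rw [h0]; simp; linarith
  · have h1 : Real.log (⌊bigP D⌋₊ : ℕ) ≤ Real.log (bigP D) :=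
      Real.log_le_log (by exact_mod_cast hpos) (Nat.floor_le hP0.le)
    linarith

/-! ## The four inputs of the Lemma-6.1 edge, 𝔓-form -/

/-- **`Σ_{ψ∈T} |K(w,ψ)|² ≤ 2e^{8π}·𝔓·𝓛⁹`** on the strip, once `2P₄ ≤ P` (`K` has length `2P₄`, weights
`|g*| ≤ 1`). [cite: Zhang2022LandauSiegel, §6 Lemma 6.1 p.30; §3 Lemma 3.3 (i)] -/
theorem meanSq_Kchar_le {D : ℕ} (hL : 1 ≤ ell D) (h2P4 : 2 * P4 D ≤ bigP D) (T : Finset (Chr D))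
    {w : ℂ} (hw : |w.re - 1 / 2| ≤ 2 * alpha D) :
    ∑ x ∈ T, ‖Kchar D (psiFn x) w‖ ^ 2 ≤ 2 * Real.exp (8 * π) * frakP D * ell D ^ 9 := by
  have hL0 : 0 < ell D := by linarith
  have hP0 : 0 < bigP D := Real.exp_pos _
  have hT0 : 0 < bigT D := Real.exp_pos _
  have ht0 : 0 ≤ t0 D := by rw [t0]; positivity
  have hN : ⌈2 * P4 D⌉₊ - 1 ≤ ⌊bigP D⌋₊ :=
    ceil_pred_le_floor_of_le (by rw [P4]; positivity) h2P4
  have h := meanSq_short_unimodular_le hL T hw hN (fun n => (gstar D (P4 D / n) : ℂ))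
    (fun n => norm_gstar_le_one hL0 _)
  have hK : ∀ x : Chr D, Kchar D (psiFn x) w =
      ∑ n ∈ Finset.Ico 1 ⌈2 * P4 D⌉₊, x.ψ (n : ZMod x.p) * (n : ℂ) ^ (-w) *
        (gstar D (P4 D / n) : ℂ) := fun x => by simp only [Kchar, psiFn]
  simp_rw [hK]
  refine h.trans ?_
  have hP : 0 ≤ frakP D := by
    rw [frakP_eq_sum_primeWindow]; exact Finset.sum_nonneg fun p _ => Nat.cast_nonneg p
  calc Real.exp (8 * π) * frakP D * (1 + Real.log (⌊bigP D⌋₊ : ℕ))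
      ≤ Real.exp (8 * π) * frakP D * (2 * ell D ^ 9) :=
        mul_le_mul_of_nonneg_left (one_add_log_floor_bigP_le hL) (by positivity)
    _ = 2 * Real.exp (8 * π) * frakP D * ell D ^ 9 := by ring

/-- **`Σ_{ψ∈T} |N(w,ψ)|² ≤ 2e^{8π}·𝔓·𝓛⁹`** on the strip, for `𝓛 ≥ 3` (`N` has length `2T² ≤ P`, weights
`|g*| ≤ 1`). [cite: Zhang2022LandauSiegel, §6 Lemma 6.1 p.30; §3 Lemma 3.3 (i)] -/
theorem meanSq_Nchar_le {D : ℕ} (hL : 3 ≤ ell D) (T : Finset (Chr D)) {w : ℂ}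
    (hw : |w.re - 1 / 2| ≤ 2 * alpha D) :
    ∑ x ∈ T, ‖Nchar D (psiFn x) w‖ ^ 2 ≤ 2 * Real.exp (8 * π) * frakP D * ell D ^ 9 := by
  have hL1 : 1 ≤ ell D := by linarith
  have hL0 : 0 < ell D := by linarith
  have hT0 : 0 < bigT D := Real.exp_pos _
  have hN : ⌈2 * bigT D ^ 2⌉₊ - 1 ≤ ⌊bigP D⌋₊ :=
    ceil_pred_le_floor_of_le (by positivity) (bigT_lengths_le_bigP hL).1
  have h := meanSq_short_unimodular_le hL1 T hw hN (fun n => (gstar D (bigT D ^ 2 / n) : ℂ))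
    (fun n => norm_gstar_le_one hL0 _)
  have hK : ∀ x : Chr D, Nchar D (psiFn x) w =
      ∑ n ∈ Finset.Ico 1 ⌈2 * bigT D ^ 2⌉₊, x.ψ (n : ZMod x.p) * (n : ℂ) ^ (-w) *
        (gstar D (bigT D ^ 2 / n) : ℂ) := fun x => by simp only [Nchar, psiFn]
  simp_rw [hK]
  refine h.trans ?_
  have hP : 0 ≤ frakP D := by
    rw [frakP_eq_sum_primeWindow]; exact Finset.sum_nonneg fun p _ => Nat.cast_nonneg p
  calc Real.exp (8 * π) * frakP D * (1 + Real.log (⌊bigP D⌋₊ : ℕ))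
      ≤ Real.exp (8 * π) * frakP D * (2 * ell D ^ 9) :=
        mul_le_mul_of_nonneg_left (one_add_log_floor_bigP_le hL1) (by positivity)
    _ = 2 * Real.exp (8 * π) * frakP D * ell D ^ 9 := by ring

/-- **`Σ_{ψ∈T} E₁(w,ψ)² ≤ 8πe^{8π}·𝔓`** on the strip, for `𝓛 ≥ 3`: the `T³`-polynomial has
`Σ_{ψ∈T}|D_{T³}(w+iv,ψ)|² ≤ 2e^{8π}𝔓𝓛⁹` uniformly in `v` (Lemma 3.3 (i), `T³ ≤ P`), and the reduction
`sum_E1main_sq_mul_le_of_pointwise` (Cauchy–Schwarz against the Gaussian) costs `4π𝓛³⁰/𝓛¹³⁶`;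
`𝓛³⁹ ≤ 𝓛¹³⁶`. [cite: Zhang2022LandauSiegel, §6 Lemma 6.1 p.31; §3 Lemma 3.3 (i)] -/
theorem meanSq_E1main_le {D : ℕ} (hL : 3 ≤ ell D) (T : Finset (Chr D)) {w : ℂ}
    (hw : |w.re - 1 / 2| ≤ 2 * alpha D) :
    ∑ x ∈ T, E1main x w ^ 2 ≤ 8 * π * Real.exp (8 * π) * frakP D := by
  have hL1 : 1 ≤ ell D := by linarith
  have hL0 : 0 < ell D := by linarith
  have hT0 : 0 < bigT D := Real.exp_pos _
  have hN : ⌈bigT D ^ 3⌉₊ - 1 ≤ ⌊bigP D⌋₊ :=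
    ceil_pred_le_floor_of_le (by positivity) (bigT_lengths_le_bigP hL).2
  have hP : 0 ≤ frakP D := by
    rw [frakP_eq_sum_primeWindow]; exact Finset.sum_nonneg fun p _ => Nat.cast_nonneg p
  -- the pointwise (uniform in `v`) bound
  have hM : ∀ v : ℝ, ∑ x ∈ T, ‖∑ n ∈ Finset.Ico 1 ⌈bigT D ^ 3⌉₊,
      x.ψ (n : ZMod x.p) * (n : ℂ) ^ (-(w + v * I))‖ ^ 2 * (fun _ => (1 : ℝ)) x ≤
        2 * Real.exp (8 * π) * frakP D * ell D ^ 9 := by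
    intro v
    have hs : |(w + v * I).re - 1 / 2| ≤ 2 * alpha D := by simpa using hw
    have h := meanSq_short_unimodular_le hL1 T hs hN (fun _ => (1 : ℂ)) (fun n => by simp)
    have he : ∀ x : Chr D, (∑ n ∈ Finset.Ico 1 ⌈bigT D ^ 3⌉₊,
        x.ψ (n : ZMod x.p) * (n : ℂ) ^ (-(w + v * I))) =
        ∑ n ∈ Finset.Ico 1 ⌈bigT D ^ 3⌉₊, x.ψ (n : ZMod x.p) * (n : ℂ) ^ (-(w + v * I)) * 1 :=
      fun x => Finset.sum_congr rfl fun n _ => (mul_one _).symm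
    simp_rw [mul_one]
    rw [show (∑ x ∈ T, ‖∑ n ∈ Finset.Ico 1 ⌈bigT D ^ 3⌉₊,
        x.ψ (n : ZMod x.p) * (n : ℂ) ^ (-(w + v * I))‖ ^ 2) =
        ∑ x ∈ T, ‖∑ n ∈ Finset.Ico 1 ⌈bigT D ^ 3⌉₊,
          x.ψ (n : ZMod x.p) * (n : ℂ) ^ (-(w + v * I)) * 1‖ ^ 2 from
      Finset.sum_congr rfl fun x _ => by rw [he x]]
    refine h.trans ?_
    calc Real.exp (8 * π) * frakP D * (1 + Real.log (⌊bigP D⌋₊ : ℕ))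
        ≤ Real.exp (8 * π) * frakP D * (2 * ell D ^ 9) :=
          mul_le_mul_of_nonneg_left (one_add_log_floor_bigP_le hL1) (by positivity)
      _ = 2 * Real.exp (8 * π) * frakP D * ell D ^ 9 := by ring
  have h := sum_E1main_sq_mul_le_of_pointwise T hL w (fun _ => (1 : ℝ)) (fun _ => zero_le_one) hM
  simp only [mul_one] at h
  refine h.trans ?_
  -- `4π·(2e^{8π}𝔓𝓛⁹)·𝓛³⁰/𝓛¹³⁶ ≤ 8πe^{8π}𝔓`
  have h136 : 0 < ell D ^ 136 := by positivity
  rw [div_le_iff₀ h136]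
  have hpow : ell D ^ 9 * ell D ^ 30 ≤ ell D ^ 136 := by
    rw [← pow_add]; exact pow_le_pow_right₀ hL1 (by norm_num)
  have hc : 0 ≤ 8 * π * Real.exp (8 * π) * frakP D := by positivity
  calc 4 * π * (2 * Real.exp (8 * π) * frakP D * ell D ^ 9) * ell D ^ 30
      = 8 * π * Real.exp (8 * π) * frakP D * (ell D ^ 9 * ell D ^ 30) := by ring
    _ ≤ 8 * π * Real.exp (8 * π) * frakP D * ell D ^ 136 := mul_le_mul_of_nonneg_left hpow hc

/-- **`#T ≤ 𝔓`** for any finite `T ⊆ Ψ` (Lemma 3.3 (i) at the constant polynomial `n = 1`: each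
character contributes `|ψ(1)|² = 1`; needs `⌊P⌋ ≥ 1`). [cite: Zhang2022LandauSiegel, §3 Lemma 3.3 (i) p.14] -/
theorem card_le_frakP {D : ℕ} (T : Finset (Chr D)) : (T.card : ℝ) ≤ frakP D := by
  classical
  have hP1 : 1 ≤ ⌊bigP D⌋₊ := Nat.le_floor (by
    have : (1 : ℝ) ≤ bigP D := Real.one_le_exp (pow_nonneg (Real.log_natCast_nonneg D) 9)
    exact_mod_cast this)
  set c : ℕ → ℂ := fun n => if n = 1 then 1 else 0 with hc
  have h := lemma33a_sum_le T 0 c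
  have hpoly : ∀ x : Chr D,
      ∑ n ∈ Finset.Icc 1 ⌊bigP D⌋₊, c n * x.ψ (n : ZMod x.p) * (n : ℂ) ^ (-(0 : ℂ)) = 1 := by
    intro x
    rw [Finset.sum_eq_single 1]
    · simp [hc]
    · intro n _ hn1; simp [hc, hn1]
    · intro h1; exact absurd (Finset.mem_Icc.mpr ⟨le_rfl, hP1⟩) h1
  have hcoef : ∑ n ∈ Finset.Icc 1 ⌊bigP D⌋₊, ‖c n‖ ^ 2 * (n : ℝ) ^ (-2 * (0 : ℂ).re) = 1 := by
    rw [Finset.sum_eq_single 1]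
    · simp [hc]
    · intro n _ hn1; simp [hc, hn1]
    · intro h1; exact absurd (Finset.mem_Icc.mpr ⟨le_rfl, hP1⟩) h1
  simp_rw [hpoly] at h
  rw [hcoef, mul_one] at h
  simpa using h

/-! ## I3-L: the mean square of `L(w,ψ)` -/

/-- **I3-L (WP14 §13 signature scratch v5 `meanSq_L_le` VERBATIM, 𝔓-form, `kL = 9`)**: under
Assumption (A), for all large `D`, every finite `T ⊆ Ψ` and every `w` with `|Re w − ½| ≤ α`,
`|Im w − 2πt₀| < 𝓛₁ + 2` (Lemma 6.1's window): `Σ_{ψ∈T} |L(w,ψ)|² ≤ C·𝔓·𝓛⁹`. Proof: pointwise, the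
reflected Lemma 6.1 (`Section6Statements.lemma61_reflected`) with `|Z(w)| ≤ e¹⁶` gives
`|L(w)|² ≤ 4(|K(w)|² + e³²|N(1−w̄,ψ)|² + C₆₁²E₁(1−w̄)² + C₆₁²)` (`norm_L_mul_sq_le` at `F = 1`); then
`Σ|K(w)|² ≤ 2e^{8π}𝔓𝓛⁹`, `Σ|N(1−w̄,ψ)|² ≤ 2e^{8π}𝔓𝓛⁹`, `Σ E₁(1−w̄)² ≤ 8πe^{8π}𝔓`, `#T ≤ 𝔓`
(`C = 4(2e^{8π} + 2e^{32+8π} + C₆₁²(8πe^{8π} + 1))`). The 𝔓-form counterpart of §8 p. 44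
"`Σ_{ψ∈Ψ₁}|L(s+β₂,ψ)L(s+β₃,ψ)|² ≪ P²𝓛³⁶`" for one factor.
[cite: Zhang2022LandauSiegel, §13 (13.11) p.75; §6 Lemma 6.1 p.31; §3 Lemma 3.3 (i) p.14] -/
theorem meanSq_L_le : ∃ C : ℝ, ForAllLarge fun D _ χ => AssumptionA D χ →
    ∀ (T : Finset (Chr D)) (w : ℂ), |w.re - 1 / 2| ≤ alpha D → |w.im - 2 * π * t0 D| < ell1 D + 2 →
      ∑ x ∈ T, ‖x.ψ.LFunction w‖ ^ 2 ≤ C * frakP D * ell D ^ 9 := by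
  obtain ⟨c, hc, C, D₀, h61⟩ := Section6Statements.lemma61_reflected
  obtain ⟨D₃, hℓ3⟩ := exists_nat_forall_le_ell 3
  obtain ⟨D₄, hP4⟩ := Typed.Sec14.exists_two_mul_P4_le_bigP
  set C61 : ℝ := max C 0 with hC61
  have hC61_0 : 0 ≤ C61 := le_max_right _ _
  set K : ℝ := 4 * (2 * Real.exp (8 * π) + Real.exp 32 * (2 * Real.exp (8 * π)) +
    C61 ^ 2 * (8 * π * Real.exp (8 * π)) + C61 ^ 2) with hK
  refine ⟨K, max D₀ (max D₃ D₄), fun D _ χ hD hq hp hA T w hwre hwim => ?_⟩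
  have hD₀ : D₀ ≤ D := le_trans (le_max_left _ _) hD
  have hL3 : 3 ≤ ell D := hℓ3 D (le_trans (le_trans (le_max_left _ _) (le_max_right _ _)) hD)
  have h2P4 : 2 * P4 D ≤ bigP D := hP4 D (le_trans (le_trans (le_max_right _ _) (le_max_right _ _)) hD)
  have hL1 : 1 ≤ ell D := by linarith
  have hα : 0 < alpha D := by
    rw [alpha, bigP, Real.log_exp]; positivity
  have hw2 : |w.re - 1 / 2| ≤ 2 * alpha D := by linarith
  have hw2' : |w.re - 1 / 2| < 2 * alpha D := by linarith
  have hw' : |(1 - (starRingEnd ℂ) w).re - 1 / 2| ≤ 2 * alpha D := by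
    have : (1 - (starRingEnd ℂ) w).re - 1 / 2 = -(w.re - 1 / 2) := by simp; ring
    rw [this, abs_neg]; exact hw2
  have hP : 0 ≤ frakP D := by
    rw [frakP_eq_sum_primeWindow]; exact Finset.sum_nonneg fun p _ => Nat.cast_nonneg p
  have h9 : (1 : ℝ) ≤ ell D ^ 9 := one_le_pow₀ hL1
  -- Lemma 6.1's remainder constant `ε = e^{−c𝓛¹⁰} ≤ 1`
  set ε : ℝ := Real.exp (-c * ell D ^ 10) with hε
  have hε0 : 0 ≤ ε := (Real.exp_pos _).le
  have hε1 : ε ≤ 1 := by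
    rw [hε]; exact Real.exp_le_one_iff.mpr (by
      have : 0 ≤ ell D ^ 10 := by positivity
      nlinarith)
  have ht : |w.im - 2 * π * ell D ^ 519| < ell D ^ 405 + 2 := by
    simp only [t0, ell1] at hwim; exact hwim
  -- pointwise
  have hpt : ∀ x ∈ T, ‖x.ψ.LFunction w‖ ^ 2 ≤
      4 * (‖Kchar D (psiFn x) w‖ ^ 2 + Real.exp 32 * ‖Nchar D (psiFn x) (1 - conj w)‖ ^ 2 +
        C61 ^ 2 * E1main x (1 - conj w) ^ 2 + C61 ^ 2) := by
    intro x _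
    have h1 := h61 D χ hD₀ hq hp hA x w hw2' hwim
    have h1' : ‖x.ψ.LFunction w - Kchar D (psiFn x) w -
        GammaFactor.Zfac x.ψ w * Nchar D (psiBarFn x) (1 - w)‖ ≤
        C61 * (E1main x (1 - (starRingEnd ℂ) w) + ε) := by
      refine h1.trans (mul_le_mul_of_nonneg_right (le_max_left _ _) ?_)
      exact add_nonneg (E1main_nonneg x _) hε0
    have h2 := norm_L_mul_sq_le x hL3 (1 : ℂ) rfl rfl hw2 ht hC61_0 hε1 h1'
    simpa only [mul_one, norm_one, one_pow] using h2
  -- the four sums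
  have hKs := meanSq_Kchar_le hL1 h2P4 T hw2
  have hNs := meanSq_Nchar_le hL3 T hw'
  have hEs := meanSq_E1main_le hL3 T hw'
  have hBs := card_le_frakP T
  calc ∑ x ∈ T, ‖x.ψ.LFunction w‖ ^ 2
      ≤ ∑ x ∈ T, 4 * (‖Kchar D (psiFn x) w‖ ^ 2 + Real.exp 32 * ‖Nchar D (psiFn x) (1 - conj w)‖ ^ 2 +
          C61 ^ 2 * E1main x (1 - conj w) ^ 2 + C61 ^ 2) := Finset.sum_le_sum hpt
    _ = 4 * (∑ x ∈ T, ‖Kchar D (psiFn x) w‖ ^ 2 +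
          Real.exp 32 * ∑ x ∈ T, ‖Nchar D (psiFn x) (1 - conj w)‖ ^ 2 +
          C61 ^ 2 * ∑ x ∈ T, E1main x (1 - conj w) ^ 2 + C61 ^ 2 * (T.card : ℝ)) := by
        rw [← Finset.mul_sum, Finset.sum_add_distrib, Finset.sum_add_distrib, Finset.sum_add_distrib,
          ← Finset.mul_sum, ← Finset.mul_sum, Finset.sum_const, nsmul_eq_mul, mul_comm (T.card : ℝ)]
    _ ≤ 4 * (2 * Real.exp (8 * π) * frakP D * ell D ^ 9 +
          Real.exp 32 * (2 * Real.exp (8 * π) * frakP D * ell D ^ 9) +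
          C61 ^ 2 * (8 * π * Real.exp (8 * π) * frakP D) + C61 ^ 2 * frakP D) := by
        gcongr
    _ ≤ 4 * (2 * Real.exp (8 * π) * frakP D * ell D ^ 9 +
          Real.exp 32 * (2 * Real.exp (8 * π) * frakP D * ell D ^ 9) +
          C61 ^ 2 * (8 * π * Real.exp (8 * π) * frakP D * ell D ^ 9) +
          C61 ^ 2 * (frakP D * ell D ^ 9)) := by
        have h1 : 8 * π * Real.exp (8 * π) * frakP D ≤
            8 * π * Real.exp (8 * π) * frakP D * ell D ^ 9 :=
          le_mul_of_one_le_right (by positivity) h9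
        have h2 : frakP D ≤ frakP D * ell D ^ 9 := le_mul_of_one_le_right hP h9
        have hC2 : 0 ≤ C61 ^ 2 := sq_nonneg _
        gcongr
    _ = K * frakP D * ell D ^ 9 := by rw [hK]; ring

/-- The same with a non-negative constant recorded and the narrower window `|Im w − 2πt₀| ≤ 𝓛₁ + 1`
(the form of the programme's earlier scratch v4). [cite: Zhang2022LandauSiegel, §13 (13.11) p.75] -/
theorem meanSq_L_le' : ∃ C : ℝ, 0 ≤ C ∧ ForAllLarge fun D _ χ => AssumptionA D χ →
    ∀ (T : Finset (Chr D)) (w : ℂ), |w.re - 1 / 2| ≤ alpha D → |w.im - 2 * π * t0 D| ≤ ell1 D + 1 →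
      ∑ x ∈ T, ‖x.ψ.LFunction w‖ ^ 2 ≤ C * frakP D * ell D ^ 9 := by
  obtain ⟨C, D₀, h⟩ := meanSq_L_le
  refine ⟨max C 0, le_max_right _ _, D₀, fun D _ χ hD hq hp hA T w hwre hwim => ?_⟩
  have h1 := h D χ hD hq hp hA T w hwre (by linarith)
  refine h1.trans (mul_le_mul_of_nonneg_right (mul_le_mul_of_nonneg_right (le_max_left _ _) ?_) ?_)
  · rw [frakP_eq_sum_primeWindow]; exact Finset.sum_nonneg fun p _ => Nat.cast_nonneg p
  · exact pow_nonneg (by rw [ell]; exact Real.log_natCast_nonneg D) 9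

end Literature.NumberTheory.LFunctions.Zhang2022.Typed.Section13
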